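import Summits.QuantumFields.YangMills.Theorems.SwapVirialDeficitSectorLaplaceMbDensitySoftCeil
import Summits.QuantumFields.YangMills.Theorems.SwapVirialDeficitSectorLaplaceEndShellLetters
import Summits.QuantumFields.YangMills.Theorems.SwapVirialDeficitBlowUpGnomonicHubAngleLetters
import HarnessLib

/-!
# Route `SwapVirialDeficit` (YangMills): THE ONE-SOFT-PAIR FLOOR OF THE MORSE–BOTT DENSITY IN THE HUB LETTER `δ` — `𝔪(hubAt δ 1, ε, p) ≳ δ·(det A_F)^{−1/2}` for `δ ≥ 1`
# (cell ym-idea-1, skeleton ➎, `stub_core_tip`: the `δ`-letter reading of ✓`mbDensity_ge_softCeil` (w2 g60 memo3 §6 SHELL side), for the tip window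
# `{(1+δ²)⁻¹ < τ}` of ✓`stub_core_tip_of_shellBound` and the shell mass in `δ` letters (✓`…EndShellLetters`);
# free-hands support of ⟨stmt-QuantumFields-24197⟩ `SwapVirialDeficit.SwapGluedStiffness`)

The tip slab and the adjacent shell of ✓`stub_core_tip_of_shellBound` are `δ`-integrals at hubs `hubAt δ 1` (✓`setIntegral_tipHub_exp_eq_hubCot`,
✓`mbDensity_eq_hubCot`), `δ = cot θ` large.  LEAD g99's dictionary ✓`gnoDeficit_hubAt_eq_angUnit` (`θ(δ) = π/2 − arctan δ`) carries w3 g68's angle-chart floor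
✓`mbDensity_ge_softCeil` over: `hubAngle_eq_arctan_inv`, `hubAngle_le_inv` (`θ(δ) = arctan δ⁻¹ ≤ δ⁻¹` for `δ > 0`), `mbDensity_angUnit_hubAngle`
(`𝔪(angUnit θ(δ)) = 𝔪(hubAt δ 1)`), and ★★ `mbDensity_hubAt_ge_softCeil` — for `δ ≥ 1`, good signs, `p ≠ 0`, a symmetric follower family with the form identity AT
`hubAt δ 1`: `ρ(gnoBase p)·(2(1+d)·122689728L⁴·δ⁻¹)^{−1}·(2(1+d)·20400L⁴)^{−5/2}·(1+1/d)^{−d/2}/√det A_F(gnoBase p) ≤ 𝔪(hubAt δ 1, ε, p)` — ORDER `δ`.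

HONEST LABEL: a corollary (dictionary only); `stub_core_tip`, `stub_end_gaussCore`, ⟨24197⟩ ∕ ⟨24194⟩ OPEN; own crux ⟨22884⟩ `LargeFieldMassRefinementTail` OPEN
(blocked-on ⟨19935⟩); the Yang–Mills mass gap is NOT proved; no summit is proved by a line.  THEOREMS ONLY (0 `def`, 0 `sorry`, no instance), standard axioms.
Width seat ym-line-sfw-p2-w3 g68 (cell ym-idea-1, free hands), `--supports stmt-QuantumFields-24197`.  References: [cite: Luscher1983, §2]; [folklore].
-/

set_option autoImplicit false
set_option synthInstance.maxSize 1024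

noncomputable section

open MeasureTheory Quaternion Set Module
open scoped Quaternion BigOperators ENNReal InnerProductSpace
open Literature.MathematicalPhysics.QuantumLattice
open Literature.MathematicalPhysics.QuantumFieldTheory hiding SU2

namespace Summit.QuantumFields.YangMills.Theorems.SwapVirialDeficit.SectorLaplace

open Summit.QuantumFields.YangMills.Theorems.FemtoTransferGap
open Summit.QuantumFields.YangMills.Theorems.FemtoTransferGap.TT
open Summit.QuantumFields.YangMills.Theorems.VirialFluxGap.RingDeficit
open Summit.QuantumFields.YangMills.Theorems.SwapVirialDeficit.SwapRing
open Summit.QuantumFields.YangMills.Theorems.SwapVirialDeficit.BlowUpRing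

variable {L : ℕ} [NeZero L]

omit [NeZero L] in
/-- `π/2 − arctan δ = arctan δ⁻¹` for `δ > 0`. [folklore] -/
theorem hubAngle_eq_arctan_inv {δ : ℝ} (hδ : 0 < δ) : Real.pi / 2 - Real.arctan δ = Real.arctan δ⁻¹ := by
  rw [Real.arctan_inv_of_pos hδ]

omit [NeZero L] in
/-- `0 < π/2 − arctan δ ≤ δ⁻¹` for `δ > 0` (`arctan` is 1-Lipschitz, ✓`abs_arctan_sub_arctan_le`). [folklore] -/
theorem hubAngle_le_inv {δ : ℝ} (hδ : 0 < δ) : Real.pi / 2 - Real.arctan δ ≤ δ⁻¹ := by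
  rw [hubAngle_eq_arctan_inv hδ]
  have h := abs_arctan_sub_arctan_le δ⁻¹ 0
  rw [Real.arctan_zero, sub_zero, sub_zero, abs_of_pos (inv_pos.2 hδ)] at h
  exact (le_abs_self _).trans h

/-- `𝔪(angUnit (π/2 − arctan δ), ε, p) = 𝔪(hubAt δ 1, ε, p)` (✓`mbDensity_eq_hubCot`, ✓`re_div_norm_im_angUnit_hubAngle`). [folklore] -/
theorem mbDensity_angUnit_hubAngle (δ : ℝ) (ε : GnoSign L) (p : ℝ × ℝ) :
    mbDensity (L := L) (angUnit (Real.pi / 2 - Real.arctan δ)) ε p = mbDensity (hubAt δ 1) ε p := by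
  have him : (angUnit (Real.pi / 2 - Real.arctan δ)).im ≠ 0 := by
    intro h
    have h1 := norm_im_angUnit (Real.pi / 2 - Real.arctan δ)
    rw [h, norm_zero] at h1
    exact (sin_hubAngle_pos δ).ne' (abs_eq_zero.1 h1.symm)
  rw [mbDensity_eq_hubCot him, re_div_norm_im_angUnit_hubAngle]

/-- ★★ **THE ONE-SOFT-PAIR FLOOR IN THE LETTER `δ`**: for `δ ≥ 1`, good signs `ε`, `p ≠ 0` and a symmetric follower family `A_F` with the form identity at the hub
`hubAt δ 1`, with `d = dim V_F`, `C = 122689728L⁴`, `Λ = 20400L⁴`: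
`gnoDensity(gnoBase p)·(2(1+d)·C·δ⁻¹)^{−1}·(2(1+d)Λ)^{−5/2}·(1+1/d)^{−d/2}·(det A_F(gnoBase p))^{−1/2} ≤ 𝔪(hubAt δ 1, ε, p)` — the shell-side floor grows like `δ`
(✓`mbDensity_ge_softCeil` at `θ(δ) = arctan δ⁻¹ ≤ δ⁻¹ ≤ 1`). [cite: Luscher1983, §2] -/
theorem mbDensity_hubAt_ge_softCeil {δ : ℝ} (hδ : 1 ≤ δ) {ε : GnoSign L} (hε : GoodSign ε) (p : ℝ × ℝ) (hp : 0 < p.1 ^ 2 + p.2 ^ 2)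
    {AF : GnoCoord L → GnoFol L →ₗ[ℝ] GnoFol L} (hFs : ∀ η, (AF η).IsSymmetric)
    (hFyy : ∀ η (y : GnoFol L), ⟪AF η y, y⟫_ℝ = iteratedFDeriv ℝ 2 (fun y' : GnoFol L => gnoDeficit z₀ (fun _ => 1) (hubAt δ 1) ε (η + gnoFolEmb y')) 0 (fun _ => y)) :
    gnoDensity (gnoBase p.1 p.2 : GnoCoord L) * ((2 * ((1 + (finrank ℝ (GnoFol L) : ℝ)) * (122689728 * (L : ℝ) ^ 4 * δ⁻¹)))⁻¹ *
        (2 * ((1 + (finrank ℝ (GnoFol L) : ℝ)) * (20400 * (L : ℝ) ^ 4))) ^ (-(5 / 2 : ℝ)) *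
        (1 + 1 / (finrank ℝ (GnoFol L) : ℝ)) ^ (-((finrank ℝ (GnoFol L) : ℝ) / 2)) / Real.sqrt (LinearMap.det (AF (gnoBase p.1 p.2)))) ≤
      mbDensity (L := L) (hubAt δ 1) ε p := by
  have hδ0 : 0 < δ := by linarith
  have hθ0 : 0 < Real.pi / 2 - Real.arctan δ := (hubAngle_mem δ).1
  have hθinv : Real.pi / 2 - Real.arctan δ ≤ δ⁻¹ := hubAngle_le_inv hδ0
  have hθ1 : Real.pi / 2 - Real.arctan δ ≤ 1 := hθinv.trans (inv_le_one_of_one_le₀ hδ)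
  -- the form identity at `angUnit θ(δ)`
  have hFyy' : ∀ η (y : GnoFol L), ⟪AF η y, y⟫_ℝ =
      iteratedFDeriv ℝ 2 (fun y' : GnoFol L => gnoDeficit z₀ (fun _ => 1) (angUnit (Real.pi / 2 - Real.arctan δ)) ε (η + gnoFolEmb y')) 0 (fun _ => y) := by
    intro η y
    rw [hFyy η y]
    simp_rw [gnoDeficit_hubAt_eq_angUnit z₀ (fun _ => (1 : SU2)) δ ε]
  have h := mbDensity_ge_softCeil hθ0 hθ1 hε p hp hFs hFyy'
  rw [mbDensity_angUnit_hubAngle] at h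
  refine le_trans ?_ h
  have hL : (0 : ℝ) < (L : ℝ) := Nat.cast_pos.2 (Nat.pos_of_ne_zero (NeZero.ne L))
  have hd9 := nine_le_finrank_gnoFol (L := L)
  have hd0 : 0 < 1 + (finrank ℝ (GnoFol L) : ℝ) := by linarith
  have hρ : 0 ≤ gnoDensity (gnoBase p.1 p.2 : GnoCoord L) := (gnoDensity_pos _).le
  refine mul_le_mul_of_nonneg_left (div_le_div_of_nonneg_right (mul_le_mul_of_nonneg_right (mul_le_mul_of_nonneg_right ?_
    (Real.rpow_nonneg (by positivity) _)) (Real.rpow_nonneg (by positivity) _)) (Real.sqrt_nonneg _)) hρ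
  -- `(2(1+d)·C·δ⁻¹)⁻¹ ≤ (2(1+d)·C·θ)⁻¹` from `θ ≤ δ⁻¹`
  exact inv_anti₀ (by positivity) (by gcongr)

end Summit.QuantumFields.YangMills.Theorems.SwapVirialDeficit.SectorLaplace

end
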